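import Literature.MathematicalPhysics.QuantumLattice.PeriodicGibbsVariationalPrinciple
import Literature.MathematicalPhysics.QuantumLattice.InfVolFermionStateWeakLimits
import Literature.MathematicalPhysics.QuantumLattice.GibbsVariationalPrincipleWitness
import Literature.MathematicalPhysics.QuantumLattice.VariationalEquilibriumExistence
import Literature.MathematicalPhysics.QuantumLattice.PeriodicCellEnergyMinimisers
import HarnessLib

/-!
# Periodic variational equilibrium states: tangent (Griffiths) windows for cell observables, and EXISTENCE for every superlattice-periodic
# interaction at every temperature

Topic `Literature/MathematicalPhysics/QuantumLattice` (family `hubbard`; crew hubbard-fast S2/S3 «T > 0 phase map for decorated / multi-band / stacked /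
staggered-field models; competing orders through staggered fields»). Periodic twin of `TIVariationalPressure` §3 + `VariationalEquilibriumExistence` for the
periodic variational pressure `P_q(β,Ψ) = sup_{ω q-periodic}[s̄(ω) − β ē_q(ω)]` (`PeriodicVariationalPressure`, `PeriodicGibbsVariationalPrinciple`):

* §1 `InfVolFermionState.IsPerVarEquilibrium β q Ψ R ω` (a `q`-periodic maximiser); the MASTER INEQUALITY `P_q(β₁,Ψ₁) ≥ P_q(β,Ψ) + βē(Ψ)(ω) − β₁ē(Ψ₁)(ω)`;
  LINEARITY of the cell energy density along linear families `Ψ(θ) = Ψ₀ + Σθ_aΨ_a` (`cellMeanEnergy_linearFamily`); the **GRIFFITHS WINDOW for cell-averaged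
  conjugate densities** `(P_q(θ) − P_q(θ+δ1_a))/(βδ) ≤ ē_q(Ψ_a)(ω) ≤ (P_q(θ−δ1_a) − P_q(θ))/(βδ)` (e.g. the STAGGERED MAGNETISATION of an equilibrium state in a
  staggered field `h_s`, the sublattice / orbital-resolved densities of a decorated model) and the energy window in `β`.
* §2 weak-⋆ limits of `q`-periodic states are `q`-periodic; the cell energy density is weak-⋆ continuous; the mean entropy is u.s.c. along periodic sequences
  (aligned boxes); **`FermionInteraction.exists_isPerVarEquilibrium`: periodic equilibrium states EXIST** for every `Ψ`, `q`, real `β`, `d ≥ 1`.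
* §3 with the periodic variational principle: for every Hermitian even `q`-periodic finite-range `Ψ` there is a `q`-periodic state realising the limit of
  the aligned box pressures, and its cell observables obey the windows of §1 fed by certified aligned-box partition functions.

Everything is PROVED; definition with body: `IsPerVarEquilibrium`; no named fact, no number. HONEST SCOPE: existence, no uniqueness; windows need `β, δ > 0`.

## Tree / Mathlib search

REUSED: `perVarPressure`, `sub_mul_le_perVarPressure`, `exists_lt_of_lt_perVarPressure`, `cellSiteNorm`, `abs_cellMeanEnergy_le_cellSiteNorm`
(`PeriodicVariationalPressure`); `cellMeanEnergy`, `siteEnergy(_apply)`, `IsPeriodic.entropyDensitySup_le_boxEntropyDensity`,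
`IsPeriodic.tendsto_boxEntropyDensity_mul`, `dvd_prod_succ` (`Periodic…`); `exists_tendsto_expect_subseq` (`InfVolFermionStateWeakLimits`);
`isPeriodic_of_tendsto_expect` (`PeriodicCellEnergyMinimisers`);
`eventually_boxEntropyDensity_le_add` (`VariationalEquilibriumExistence`); `linearFamily_apply`; Mathlib `tendsto_finsetSum`,
`tendsto_of_tendsto_of_tendsto_of_le_of_le`, `tendsto_one_div_add_atTop_nhds_zero_nat`.

## References

* R. B. Israel, *Convexity in the Theory of Lattice Gases* (1979), Thm. I.2.4 / §II.3 (tangent functionals; periodic states). [cite: Israel1979, Thm. I.2.4]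
* R. B. Griffiths, J. Math. Phys. 5 (1964) 1215, eq. (39). [cite: Griffiths1964, Eq. (39) and Fig. 3]
* O. Bratteli, D. W. Robinson, *OAQSM 2* (1997), Thm. 6.2.40, Prop. 6.2.38. [cite: BratteliRobinsonII1997, Thm. 6.2.40]
-/

noncomputable section

open scoped ComplexOrder BigOperators Matrix.Norms.L2Operator
open Finset Literature.InformationTheory.Entropy

namespace Literature.MathematicalPhysics.QuantumLattice

open Matrix HubbardWave0 Literature.Probability.LatticeModels ThermodynamicLimit
open _root_.Filter
open scoped _root_.Topology

namespace InfVolFermionState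

variable {d : ℕ} {q : Fin d → ℕ}

/-! ### §1. Periodic equilibrium states and their tangent windows -/

/-- **A periodic variational equilibrium state** of `Ψ` at inverse temperature `β`: a `q`-periodic maximiser of `s̄ − β ē_q`.
[cite: Israel1979, Thm. I.2.4] -/
def IsPerVarEquilibrium (β : ℝ) (q : Fin d → ℕ) (Ψ : FermionInteraction d) (R : ℝ) (ω : InfVolFermionState d) : Prop :=
  ω.IsPeriodic q ∧ ω.entropyDensitySup - β * cellMeanEnergy q Ψ ω R = Ψ.perVarPressure β q R

variable {β : ℝ} {Ψ : FermionInteraction d} {R : ℝ} {ω : InfVolFermionState d}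

/-- **MASTER INEQUALITY (joint tangent plane)**: for a periodic equilibrium `ω` of `(β,Ψ)` and every `(β₁,Ψ₁)`:
`P_q(β,Ψ) + βē(Ψ)(ω) − β₁ē(Ψ₁)(ω) ≤ P_q(β₁,Ψ₁)`. [cite: Israel1979, Thm. I.2.4] -/
theorem IsPerVarEquilibrium.perVarPressure_add_le (h : ω.IsPerVarEquilibrium β q Ψ R) (β₁ : ℝ) (Ψ₁ : FermionInteraction d) (R₁ : ℝ) :
    Ψ.perVarPressure β q R + β * cellMeanEnergy q Ψ ω R - β₁ * cellMeanEnergy q Ψ₁ ω R₁ ≤ Ψ₁.perVarPressure β₁ q R₁ := by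
  have h1 := Ψ₁.sub_mul_le_perVarPressure β₁ q R₁ h.1
  rw [← h.2]
  linarith

/-- **Energy is antitone in `β` across periodic equilibria**: `(β₁ − β)(ē(ω₁) − ē(ω)) ≤ 0`. [cite: Israel1979, Thm. I.2.4] -/
theorem IsPerVarEquilibrium.mul_sub_cellMeanEnergy_sub_nonpos (h : ω.IsPerVarEquilibrium β q Ψ R) {β₁ : ℝ} {ω₁ : InfVolFermionState d}
    (h₁ : ω₁.IsPerVarEquilibrium β₁ q Ψ R) :
    (β₁ - β) * (cellMeanEnergy q Ψ ω₁ R - cellMeanEnergy q Ψ ω R) ≤ 0 := by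
  have a := h.perVarPressure_add_le β₁ Ψ R
  have b := h₁.perVarPressure_add_le β Ψ R
  nlinarith

section Family

variable {ι : Type*} [Fintype ι] (Ψ₀ : FermionInteraction d) (Ψv : ι → FermionInteraction d)

/-- **The site energy is linear along a linear family**: `ε_{Ψ(θ)}(x) = ε_{Ψ₀}(x) + Σ_a θ_a ε_{Ψ_a}(x)`. [cite: KomaTasaki1994, §1] -/
theorem siteEnergy_linearFamily (θ : ι → ℝ) (ω : InfVolFermionState d) (R : ℝ) (x : Site d) :
    siteEnergy (FermionInteraction.linearFamily Ψ₀ Ψv θ) ω R x = siteEnergy Ψ₀ ω R x + ∑ a, ((θ a : ℝ) : ℂ) * siteEnergy (Ψv a) ω R x := by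
  simp only [siteEnergy_apply, FermionInteraction.linearFamily_apply, map_add, map_sum, map_smul, smul_eq_mul, mul_add, Finset.mul_sum,
    Finset.sum_add_distrib]
  congr 1
  rw [Finset.sum_comm]
  refine Finset.sum_congr rfl fun a _ => Finset.sum_congr rfl fun Y _ => ?_
  ring

/-- **The cell energy density is linear along a linear family**: `ē_q(Ψ(θ))(ω) = ē_q(Ψ₀)(ω) + Σ_a θ_a ē_q(Ψ_a)(ω)`. [cite: KomaTasaki1994, §1] -/
theorem cellMeanEnergy_linearFamily (θ : ι → ℝ) (ω : InfVolFermionState d) (R : ℝ) :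
    cellMeanEnergy q (FermionInteraction.linearFamily Ψ₀ Ψv θ) ω R = cellMeanEnergy q Ψ₀ ω R + ∑ a, θ a * cellMeanEnergy q (Ψv a) ω R := by
  simp only [cellMeanEnergy, siteEnergy_linearFamily, Complex.add_re, Complex.re_sum, Complex.re_ofReal_mul, Finset.sum_add_distrib, mul_add,
    Finset.mul_sum]
  congr 1
  rw [Finset.sum_comm]
  refine Finset.sum_congr rfl fun a _ => Finset.sum_congr rfl fun c _ => ?_
  ring

/-- Difference of two members of the family: `ē(Ψ(θ)) = ē(Ψ(θ')) + Σ_a (θ_a − θ'_a) ē(Ψ_a)`. [cite: KomaTasaki1994, §1] -/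
theorem cellMeanEnergy_linearFamily_eq_add_sum_sub_mul (θ θ' : ι → ℝ) (ω : InfVolFermionState d) (R : ℝ) :
    cellMeanEnergy q (FermionInteraction.linearFamily Ψ₀ Ψv θ) ω R =
      cellMeanEnergy q (FermionInteraction.linearFamily Ψ₀ Ψv θ') ω R + ∑ a, (θ a - θ' a) * cellMeanEnergy q (Ψv a) ω R := by
  rw [cellMeanEnergy_linearFamily, cellMeanEnergy_linearFamily, add_assoc, ← Finset.sum_add_distrib]
  exact congrArg _ (Finset.sum_congr rfl fun a _ => by ring)

variable {Ψ₀ Ψv}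

/-- **Coupling update**: for a periodic equilibrium `ω` at `θ`: `P_q(θ + δ1_a) ≥ P_q(θ) − βδ ē_q(Ψ_a)(ω)`. [cite: Israel1979, Thm. I.2.4] -/
theorem IsPerVarEquilibrium.perVarPressure_sub_mul_le_update [DecidableEq ι] {θ : ι → ℝ}
    (h : ω.IsPerVarEquilibrium β q (FermionInteraction.linearFamily Ψ₀ Ψv θ) R) (a : ι) (δ : ℝ) :
    (FermionInteraction.linearFamily Ψ₀ Ψv θ).perVarPressure β q R - β * δ * cellMeanEnergy q (Ψv a) ω R ≤
      (FermionInteraction.linearFamily Ψ₀ Ψv (θ + Pi.single a δ)).perVarPressure β q R := by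
  set θ' : ι → ℝ := θ + Pi.single a δ with hθ'
  have hm := h.perVarPressure_add_le β (FermionInteraction.linearFamily Ψ₀ Ψv θ') R
  rw [cellMeanEnergy_linearFamily_eq_add_sum_sub_mul Ψ₀ Ψv θ' θ ω R] at hm
  have hs : ∑ x, (θ' x - θ x) * cellMeanEnergy q (Ψv x) ω R = δ * cellMeanEnergy q (Ψv a) ω R := by
    simp only [hθ', Pi.add_apply, add_sub_cancel_left]
    rw [Finset.sum_eq_single a]
    · rw [Pi.single_eq_same]
    · intro b _ hb; rw [Pi.single_eq_of_ne hb, zero_mul]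
    · intro ha; exact absurd (Finset.mem_univ a) ha
  rw [hs] at hm
  linarith

/-- **GRIFFITHS WINDOW FOR CELL-AVERAGED CONJUGATE DENSITIES of a periodic equilibrium state** at couplings `θ` (`β, δ > 0`):
`(P_q(θ) − P_q(θ+δ1_a))/(βδ) ≤ ē_q(Ψ_a)(ω) ≤ (P_q(θ−δ1_a) − P_q(θ))/(βδ)` — e.g. the staggered magnetisation per site in a staggered field, or a
sublattice-resolved density of a decorated model, from three periodic pressures. [cite: Griffiths1964, Eq. (39) and Fig. 3] [cite: Israel1979, Thm. I.2.4] -/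
theorem IsPerVarEquilibrium.cellMeanEnergy_mem_Icc [DecidableEq ι] {θ : ι → ℝ} (hβ : 0 < β)
    (h : ω.IsPerVarEquilibrium β q (FermionInteraction.linearFamily Ψ₀ Ψv θ) R) (a : ι) {δ : ℝ} (hδ : 0 < δ) :
    cellMeanEnergy q (Ψv a) ω R ∈ Set.Icc
      (((FermionInteraction.linearFamily Ψ₀ Ψv θ).perVarPressure β q R -
          (FermionInteraction.linearFamily Ψ₀ Ψv (θ + Pi.single a δ)).perVarPressure β q R) / (β * δ))
      (((FermionInteraction.linearFamily Ψ₀ Ψv (θ + Pi.single a (-δ))).perVarPressure β q R -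
          (FermionInteraction.linearFamily Ψ₀ Ψv θ).perVarPressure β q R) / (β * δ)) := by
  have hβδ : 0 < β * δ := mul_pos hβ hδ
  have hup := h.perVarPressure_sub_mul_le_update a δ
  have hdn := h.perVarPressure_sub_mul_le_update a (-δ)
  constructor
  · rw [div_le_iff₀ hβδ]; linarith
  · rw [le_div_iff₀ hβδ]; linarith

end Family

/-- **Energy window in `β`** for a periodic equilibrium (`δ > 0`): `(P_q(β) − P_q(β+δ))/δ ≤ ē_q(ω) ≤ (P_q(β−δ) − P_q(β))/δ`. [cite: Israel1979, Thm. I.2.4] -/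
theorem IsPerVarEquilibrium.cellMeanEnergy_mem_Icc_beta (h : ω.IsPerVarEquilibrium β q Ψ R) {δ : ℝ} (hδ : 0 < δ) :
    cellMeanEnergy q Ψ ω R ∈ Set.Icc ((Ψ.perVarPressure β q R - Ψ.perVarPressure (β + δ) q R) / δ)
      ((Ψ.perVarPressure (β - δ) q R - Ψ.perVarPressure β q R) / δ) := by
  have hup := h.perVarPressure_add_le (β + δ) Ψ R
  have hdn := h.perVarPressure_add_le (β - δ) Ψ R
  constructor
  · rw [div_le_iff₀ hδ]; linarith
  · rw [le_div_iff₀ hδ]; linarith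

/-! ### §2. Existence of periodic equilibrium states -/

variable {ωs : ℕ → InfVolFermionState d} {ωl : InfVolFermionState d}

/-- **The cell energy density is weak-⋆ continuous** (a finite sum of local expectations). [cite: BratteliKishimotoRobinson1978, §3 (mean energy functional)] -/
theorem tendsto_cellMeanEnergy_of_tendsto_expect
    (hlim : ∀ (Λ : Finset (Site d)) (A : FermionOp Λ), Tendsto (fun j => (ωs j).expect Λ A) atTop (𝓝 (ωl.expect Λ A)))
    (q : Fin d → ℕ) (Ψ : FermionInteraction d) (R : ℝ) :
    Tendsto (fun j => cellMeanEnergy q Ψ (ωs j) R) atTop (𝓝 (cellMeanEnergy q Ψ ωl R)) := by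
  have hsite : ∀ x : Site d, Tendsto (fun j => siteEnergy Ψ (ωs j) R x) atTop (𝓝 (siteEnergy Ψ ωl R x)) := by
    intro x
    simp only [siteEnergy_apply]
    exact tendsto_finsetSum _ fun Y _ => (hlim Y (Ψ.Φ Y)).const_mul _
  simp only [cellMeanEnergy]
  exact (tendsto_finsetSum _ fun c _ => (Complex.continuous_re.tendsto _).comp (hsite (cellPos c))).const_mul _

/-- **Upper semicontinuity of the mean entropy along periodic sequences** (`d ≥ 1`): if `q`-periodic `ω_j` converge on local observables to `ω`, then for every
`ε > 0` eventually `s̄(ω_j) ≤ s̄(ω) + ε` (aligned boxes). [cite: BratteliRobinsonII1997, Thm. 6.2.40] [cite: ArakiMoriya2003, Theorem 3.8 and §10] -/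
theorem eventually_entropyDensitySup_le_add_of_isPeriodic (hd : 0 < d)
    (hlim : ∀ (Λ : Finset (Site d)) (A : FermionOp Λ), Tendsto (fun j => (ωs j).expect Λ A) atTop (𝓝 (ωl.expect Λ A)))
    (hper : ∀ j, (ωs j).IsPeriodic q) {ε : ℝ} (hε : 0 < ε) :
    ∀ᶠ j in atTop, (ωs j).entropyDensitySup ≤ ωl.entropyDensitySup + ε := by
  have hl : ωl.IsPeriodic q := isPeriodic_of_tendsto_expect hlim hper
  set L := ∏ j, (q j + 1) with hL
  have hL1 : 1 ≤ L := Finset.prod_pos fun j _ => Nat.succ_pos _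
  have hLq : ∀ i, (q i + 1) ∣ L := dvd_prod_succ q
  -- an aligned box `(k+1)L` on which `ω` nearly attains its mean entropy
  have hconv := hl.tendsto_boxEntropyDensity_mul hd hL1 hLq
  have hbox := (tendsto_order.1 (hconv.comp (tendsto_add_atTop_nat 1))).2 _ (lt_add_of_pos_right _ (half_pos hε))
  obtain ⟨k, hk⟩ := hbox.exists
  simp only [Function.comp_apply] at hk
  have hm1 : 1 ≤ (k + 1) * L := Nat.one_le_iff_ne_zero.2 (Nat.mul_ne_zero (by omega) (by omega))
  filter_upwards [eventually_boxEntropyDensity_le_add hlim ((k + 1) * L) (half_pos hε)] with j hj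
  have h1 := (hper j).entropyDensitySup_le_boxEntropyDensity hd hm1 (fun i => Dvd.dvd.mul_left (hLq i) (k + 1))
  linarith

/-- **Weak-⋆ limits of approximately maximising periodic sequences are periodic equilibrium states.** [cite: BratteliRobinsonII1997, Thm. 6.2.40] -/
theorem isPerVarEquilibrium_of_tendsto_expect_of_tendsto (hd : 0 < d) {β : ℝ} {Ψ : FermionInteraction d} {R : ℝ}
    (hlim : ∀ (Λ : Finset (Site d)) (A : FermionOp Λ), Tendsto (fun j => (ωs j).expect Λ A) atTop (𝓝 (ωl.expect Λ A)))
    (hper : ∀ j, (ωs j).IsPeriodic q)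
    (hF : Tendsto (fun j => (ωs j).entropyDensitySup - β * cellMeanEnergy q Ψ (ωs j) R) atTop (𝓝 (Ψ.perVarPressure β q R))) :
    ωl.IsPerVarEquilibrium β q Ψ R := by
  have hl : ωl.IsPeriodic q := isPeriodic_of_tendsto_expect hlim hper
  refine ⟨hl, le_antisymm (Ψ.sub_mul_le_perVarPressure β q R hl) ?_⟩
  have he := tendsto_cellMeanEnergy_of_tendsto_expect hlim q Ψ R
  refine le_of_forall_pos_le_add fun ε hε => ?_
  have h3 : 0 < ε / 3 := by linarith
  have hβe : Tendsto (fun j => β * cellMeanEnergy q Ψ (ωs j) R) atTop (𝓝 (β * cellMeanEnergy q Ψ ωl R)) := he.const_mul β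
  have ev1 := (tendsto_order.1 hF).1 _ (sub_lt_self _ h3)
  have ev2 := eventually_entropyDensitySup_le_add_of_isPeriodic hd hlim hper h3
  have ev3 := (tendsto_order.1 hβe).1 _ (sub_lt_self _ h3)
  obtain ⟨j, ⟨hj1, hj2⟩, hj3⟩ := ((ev1.and ev2).and ev3).exists
  linarith

/-- **Weak-⋆ limits of periodic equilibrium states are periodic equilibrium states.** [cite: Israel1979, Thm. I.2.4] -/
theorem isPerVarEquilibrium_of_tendsto_expect (hd : 0 < d) {β : ℝ} {Ψ : FermionInteraction d} {R : ℝ}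
    (hlim : ∀ (Λ : Finset (Site d)) (A : FermionOp Λ), Tendsto (fun j => (ωs j).expect Λ A) atTop (𝓝 (ωl.expect Λ A)))
    (heq : ∀ j, (ωs j).IsPerVarEquilibrium β q Ψ R) : ωl.IsPerVarEquilibrium β q Ψ R := by
  refine isPerVarEquilibrium_of_tendsto_expect_of_tendsto hd hlim (fun j => (heq j).1) ?_
  have h : (fun j => (ωs j).entropyDensitySup - β * cellMeanEnergy q Ψ (ωs j) R) = fun _ => Ψ.perVarPressure β q R := funext fun j => (heq j).2
  rw [h]
  exact tendsto_const_nhds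

end InfVolFermionState

namespace FermionInteraction

variable {d : ℕ}

/-- **PERIODIC EQUILIBRIUM STATES EXIST**: for every interaction `Ψ`, superlattice `q`, range parameter `R`, real `β` and `d ≥ 1` there is a `q`-periodic state
with `s̄(ω) − β ē_q(ω) = P_q(β,Ψ,R)`. [cite: BratteliRobinsonII1997, Thm. 6.2.40] [cite: Israel1979, Thm. I.2.4] -/
theorem exists_isPerVarEquilibrium (hd : 0 < d) (β : ℝ) (q : Fin d → ℕ) (Ψ : FermionInteraction d) (R : ℝ) :
    ∃ ω : InfVolFermionState d, ω.IsPerVarEquilibrium β q Ψ R := by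
  have hseq : ∀ k : ℕ, ∃ ω : InfVolFermionState d, ω.IsPeriodic q ∧
      Ψ.perVarPressure β q R - 1 / ((k : ℝ) + 1) < ω.entropyDensitySup - β * InfVolFermionState.cellMeanEnergy q Ψ ω R := fun k =>
    Ψ.exists_lt_of_lt_perVarPressure β q R (sub_lt_self _ (by positivity))
  choose ωs hper hlt using hseq
  obtain ⟨φ, hφ, ωl, hlim⟩ := InfVolFermionState.exists_tendsto_expect_subseq ωs
  refine ⟨ωl, InfVolFermionState.isPerVarEquilibrium_of_tendsto_expect_of_tendsto hd hlim (fun j => hper (φ j)) ?_⟩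
  have hlow : Tendsto (fun j => Ψ.perVarPressure β q R - 1 / ((φ j : ℝ) + 1)) atTop (𝓝 (Ψ.perVarPressure β q R)) := by
    have h0 : Tendsto (fun j => 1 / ((φ j : ℝ) + 1)) atTop (𝓝 0) :=
      (tendsto_one_div_add_atTop_nhds_zero_nat (𝕜 := ℝ)).comp hφ.tendsto_atTop
    have h := (tendsto_const_nhds (x := Ψ.perVarPressure β q R)).sub h0
    rwa [sub_zero] at h
  exact tendsto_of_tendsto_of_tendsto_of_le_of_le hlow tendsto_const_nhds (fun j => (hlt (φ j)).le) fun j =>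
    Ψ.sub_mul_le_perVarPressure β q R (hper (φ j))

/-- **The periodic variational pressure is attained.** [cite: BratteliRobinsonII1997, Thm. 6.2.40] -/
theorem exists_entropyDensitySup_sub_mul_eq_perVarPressure (hd : 0 < d) (β : ℝ) (q : Fin d → ℕ) (Ψ : FermionInteraction d) (R : ℝ) :
    ∃ ω : InfVolFermionState d, ω.IsPeriodic q ∧ ω.entropyDensitySup - β * InfVolFermionState.cellMeanEnergy q Ψ ω R = Ψ.perVarPressure β q R := by
  obtain ⟨ω, hω⟩ := Ψ.exists_isPerVarEquilibrium hd β q R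
  exact ⟨ω, hω.1, hω.2⟩

/-! ### §3. Thermodynamic-limit equilibrium states of periodic models, read by aligned boxes -/

/-- **THERMODYNAMIC-LIMIT EQUILIBRIUM STATES OF A PERIODIC MODEL EXIST AND REALISE THE LIMIT OF THE ALIGNED BOX PRESSURES**: for `Ψ` Hermitian, even,
`q`-periodic of finite range `R` (`d ≥ 1`) and every real `β` there is a `q`-periodic `ω` with
`s̄(ω) − β ē_q(ω) = lim_k N_k^{-d} log Re Tr e^{−βH_{[0,N_k)^d}}`, `N_k = k·Π_i(q_i+1)`. [cite: BratteliRobinsonII1997, Thm. 6.2.40] -/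
theorem exists_isPeriodic_tendsto_boxLogPartitionFn (hd : 0 < d) {q : Fin d → ℕ} {Ψ : FermionInteraction d} {R : ℝ} (hH : Ψ.IsHermitian)
    (hE : Ψ.IsEven) (hΨ : Ψ.IsPeriodic q) (hR : Ψ.HasFiniteRange R) (β : ℝ) :
    ∃ ω : InfVolFermionState d, ω.IsPeriodic q ∧
      Tendsto (fun k : ℕ => Real.log (Matrix.partitionFn β (Ψ.localHamiltonian (halfOpenBox d (k * ∏ i, (q i + 1))))).re /
        (((k * ∏ i, (q i + 1) : ℕ) : ℝ) ^ d)) atTop (𝓝 (ω.entropyDensitySup - β * InfVolFermionState.cellMeanEnergy q Ψ ω R)) := by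
  obtain ⟨ω, hω, heq⟩ := Ψ.exists_entropyDensitySup_sub_mul_eq_perVarPressure hd β q R
  exact ⟨ω, hω, heq ▸ tendsto_boxLogPartitionFn_perVarPressure hd hH hE hΨ hR β⟩

/-- **CELL OBSERVABLES OF PERIODIC EQUILIBRIA FROM THREE ALIGNED-BOX PARTITION FUNCTIONS** (abstract floor/cap form): at couplings `θ` of a linear family with
all members as in the principle, an equilibrium state exists and, given a floor `L₀ ≤ P_q(θ)` and caps `P_q(θ ± δ1_a) ≤ U±` (e.g. from
`le_perVarPressure_of_le_log_partitionFn` / `perVarPressure_le_of_log_partitionFn_le`), EVERY equilibrium state has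
`(L₀ − U₊)/(βδ) ≤ ē_q(Ψ_a)(ω) ≤ (U₋ − L₀)/(βδ)` (`β, δ > 0`). [cite: Griffiths1964, Eq. (39) and Fig. 3] [cite: Israel1979, Thm. I.2.4] -/
theorem IsPerVarEquilibrium.cellMeanEnergy_mem_Icc_of_bounds {q : Fin d → ℕ} {ι : Type*} [Fintype ι] [DecidableEq ι] {Ψ₀ : FermionInteraction d}
    {Ψv : ι → FermionInteraction d} {θ : ι → ℝ} {R β : ℝ} (hβ : 0 < β) {ω : InfVolFermionState d}
    (h : ω.IsPerVarEquilibrium β q (linearFamily Ψ₀ Ψv θ) R) (a : ι) {δ : ℝ} (hδ : 0 < δ) {L₀ Uplus Uminus : ℝ}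
    (hL : L₀ ≤ (linearFamily Ψ₀ Ψv θ).perVarPressure β q R)
    (hUp : (linearFamily Ψ₀ Ψv (θ + Pi.single a δ)).perVarPressure β q R ≤ Uplus)
    (hUm : (linearFamily Ψ₀ Ψv (θ + Pi.single a (-δ))).perVarPressure β q R ≤ Uminus) :
    InfVolFermionState.cellMeanEnergy q (Ψv a) ω R ∈ Set.Icc ((L₀ - Uplus) / (β * δ)) ((Uminus - L₀) / (β * δ)) := by
  have hw := h.cellMeanEnergy_mem_Icc hβ a hδ
  have hβδ : 0 < β * δ := mul_pos hβ hδ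
  constructor
  · exact le_trans (div_le_div_of_nonneg_right (by linarith) hβδ.le) hw.1
  · exact le_trans hw.2 (div_le_div_of_nonneg_right (by linarith) hβδ.le)

end FermionInteraction

end Literature.MathematicalPhysics.QuantumLattice

end
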